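import Summits.AtomisticToContinuum.Crystallization.Theorems.OverbindingBudgetEnergyCubeCounting
import Summits.AtomisticToContinuum.Crystallization.Theorems.OverbindingBudgetEnergyAffineFloor
import Summits.AtomisticToContinuum.Crystallization.Theorems.ChartedPlanarOrderStraddleSummable

/-!
# OverbindingBudget · decomp-a2c lens-4 g34 — part XXII-T: THIN `LayerProfileThin` HOLDS; cone XXXVI

Helper file under `--supports stmt-AtomisticToContinuum-31280` (RDEF = `Theses.OverbindingBudget.RobustDefectLimitWindows`); closes nothing.

THIN (part Q, `LayerProfileThin Λ₁`): for a separated stacked layered configuration with gap heights in `[3/8, 23/20]`, the layer profile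
`N_m = #(F ∩ layer m)` of the sites `F` in a coordinate cube of side `ℓ` has total variation `≤ ε·#F` once `ℓ ≥ ℓ₁(ε)`.

PROOF (elementary counting).
* `exists_short_step`: the step `w (m+1) − w m` has a lattice translate `g_m ∈ (w (m+1) − w m) + ℤa + ℤb` with `‖g_m‖ ≤ R₀ = 23/20 + (‖a‖+‖b‖)/2`
  (`span{a, b} = n^⊥`, `…StraddleSummable.exists_coeffs_of_inner_eq_zero`, round the coefficients);
* `layer_card_le`: `y ↦ y + g_m` maps the layer-`m` sites of `F` at coordinate distance `≥ R₀` from `∂Q` injectively into the layer-`(m+1)`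
  sites of `F`, so `N_m − N_{m+1} ≤ S_m := #(F ∩ layer m ∩ shell_{R₀})`, and symmetrically; hence `Σ_m |N_{m+1} − N_m| ≤ 2·#(F ∩ shell_{R₀})`
  (`sum_abs_layerCount_sub_le`);
* `exists_near_layered`: every point of space is within `R₁ = 23/40 + (‖a‖+‖b‖)/2 < 2` of the configuration (heights grow by `≥ 3/8` and
  `≤ 23/20` per layer; in-plane density `exists_layerPoint_near`);
* part S: `#(F ∩ shell) = O(ℓ²)` (`card_filter_shell_le`) and `#F ≥ (ℓ/4 − 2)³` (`card_ge_of_covering`).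
★ `layerProfileThin_holds : Λ₁ ≤ 17/16 → LayerProfileThin Λ₁`.  Hence STR-A `AffineStraightenedFloor (17/16)` holds outright
(`affineStraightenedFloor_holds`, via part R), and cone XXXVI `rdef_thirtysixth_of_recordK_ref` = cone XXXV with THIN discharged: beneath
★ `StackedCellPinningU` only GEO-OSC `StackedHeightsOsc (17/16) ω` [CERT·S] and FIN-A-T / FIN-A-S [finite CERT·M] remain.
-/

noncomputable section

namespace Summit.AtomisticToContinuum.Crystallization.Theorems.OverbindingBudgetEnergyThinProfiles

open Real Finset
open scoped RealInnerProductSpace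
open Literature.MathematicalPhysics.StatisticalMechanics (lennardJones groundStateEnergy)
open Summit.AtomisticToContinuum.Crystallization.Theses.OverbindingBudget (RobustDefectLimitWindows)
open Summit.AtomisticToContinuum.Crystallization.Theses.PricedLinkCensus (ChargedEnergyGap)
open Summit.AtomisticToContinuum.Crystallization.Theorems.ChargedEnergyGapNegative (eStar)
open Summit.AtomisticToContinuum.Crystallization.Theorems.OverbindingBudgetGradedBareness (CleanlessExcessT)
open Summit.AtomisticToContinuum.Crystallization.Theorems.OverbindingBudgetCoherentCut (CoherentResidual)
open Summit.AtomisticToContinuum.Crystallization.Theorems.OverbindingBudgetUniformCutStatements (GrossCleanBallsU)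
open Summit.AtomisticToContinuum.Crystallization.Theorems.OverbindingBudgetElasticSplitScale (CompressedVirialLaw)
open Summit.AtomisticToContinuum.Crystallization.Theorems.ChartedPlanarOrderChunkFloor (E3)
open Summit.AtomisticToContinuum.Crystallization.Theorems.ChartedPlanarOrderDensityDichotomy (IsSep)
open Summit.AtomisticToContinuum.Crystallization.Theorems.ChartedPlanarOrderDoorLayered (Layered)
open Summit.AtomisticToContinuum.Crystallization.Theorems.ChartedPlanarOrderProfileSlavingLJ (incr)
open Summit.AtomisticToContinuum.Crystallization.Theorems.OverbindingBudgetScaleWidening (DoorPeriodicW)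
open Summit.AtomisticToContinuum.Crystallization.Theorems.OverbindingBudgetTwoShellShape (TwoShellShape BarlowGluingW)
open Summit.AtomisticToContinuum.Crystallization.Theorems.OverbindingBudgetStackedRigidityW (StackedReductionW GapStressVanishesW)
open Summit.AtomisticToContinuum.Crystallization.Theorems.OverbindingBudgetRegistryCut (IsUnitNormal RegistryResidual RegistryTube)
open Summit.AtomisticToContinuum.Crystallization.Theorems.OverbindingBudgetRegistryDichotomy (RegistryGeometryW BalancedLocus)
open Summit.AtomisticToContinuum.Crystallization.Theorems.OverbindingBudgetRegistryDichotomyCW (RegistryMetricCW)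
open Summit.AtomisticToContinuum.Crystallization.Theorems.OverbindingBudgetEnergyTubeBox (RegistryPinningP TubeConvexRefP)
open Summit.AtomisticToContinuum.Crystallization.Theorems.OverbindingBudgetEnergyAffineStraightening
  (AffineStraightenedFloor StackedHeightsOsc AffineCellEnergyT AffineSquareExtinct)
open Summit.AtomisticToContinuum.Crystallization.Theorems.OverbindingBudgetEnergySiteDecomposition (strictMono_heights)
open Summit.AtomisticToContinuum.Crystallization.Theorems.OverbindingBudgetEnergyLayerProfile
  (layerOf layerCount layerOf_spec layerOf_eq LayerProfileThin)
open Summit.AtomisticToContinuum.Crystallization.Theorems.OverbindingBudgetEnergyAffineFloor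
  (affineStraightenedFloor_of_thin rdef_thirtyfifth_of_recordK_thin_ref)
open Summit.AtomisticToContinuum.Crystallization.Theorems.OverbindingBudgetEnergyCubeCounting (card_filter_shell_le card_ge_of_covering)
open Summit.AtomisticToContinuum.Crystallization.Theorems.ChartedPlanarOrderNashForceBalance (layerPoint)
open Summit.AtomisticToContinuum.Crystallization.Theorems.ChartedPlanarOrderStraddleSummable
  (exists_coeffs_of_inner_eq_zero exists_layerPoint_near)

variable {a b n : E3} {w : ℤ → E3}

/-! ## §1 Heights and the covering radius of a stacked layered configuration -/

/-- heights grow by at least `3/8` per layer. [this file] -/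
theorem height_add_nat_ge (hband : ∀ m : ℤ, 3 / 8 ≤ ⟪incr w m, n⟫ ∧ ⟪incr w m, n⟫ ≤ 23 / 20) (m : ℤ) (k : ℕ) :
    ⟪w m, n⟫ + 3 / 8 * k ≤ ⟪w (m + k), n⟫ := by
  induction k with
  | zero => simp
  | succ k ih =>
    have h := (hband (m + k + 1)).1
    have e : incr w (m + k + 1) = w (m + k + 1) - w (m + k) := by simp [incr]
    rw [e, inner_sub_left] at h
    push_cast
    rw [← add_assoc]
    linarith

/-- every real height is within `23/40` of a layer height. [this file] -/
theorem exists_layer_near_height (hband : ∀ m : ℤ, 3 / 8 ≤ ⟪incr w m, n⟫ ∧ ⟪incr w m, n⟫ ≤ 23 / 20) (x₀ : ℝ) :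
    ∃ m : ℤ, |x₀ - ⟪w m, n⟫| ≤ 23 / 40 := by
  have hP : ∃ ub : ℤ, ⟪w ub, n⟫ ≤ x₀ ∧ ∀ z : ℤ, ⟪w z, n⟫ ≤ x₀ → z ≤ ub := by
    apply Int.exists_greatest_of_bdd
    · refine ⟨((⌈8 * (x₀ - ⟪w 0, n⟫) / 3⌉₊ : ℕ) : ℤ), fun z hz => ?_⟩
      by_contra hlt
      push Not at hlt
      have hz0 : 0 ≤ z := le_trans (by positivity) hlt.le
      obtain ⟨k, rfl⟩ := Int.eq_ofNat_of_zero_le hz0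
      have h1 := height_add_nat_ge hband 0 k
      rw [zero_add] at h1
      have h2 : ((⌈8 * (x₀ - ⟪w 0, n⟫) / 3⌉₊ : ℕ) : ℝ) < k := by exact_mod_cast hlt
      have h3 := Nat.le_ceil (8 * (x₀ - ⟪w 0, n⟫) / 3)
      linarith
    · obtain ⟨k, hk⟩ := exists_nat_ge (8 * (⟪w 0, n⟫ - x₀) / 3)
      refine ⟨-(k : ℤ), ?_⟩
      have h1 := height_add_nat_ge hband (-(k : ℤ)) k
      rw [neg_add_cancel] at h1
      linarith
  obtain ⟨ub, hub, hmax⟩ := hP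
  have hnext : x₀ < ⟪w (ub + 1), n⟫ := by
    by_contra hle
    push Not at hle
    have := hmax (ub + 1) hle
    linarith
  have hstep : ⟪w (ub + 1), n⟫ ≤ ⟪w ub, n⟫ + 23 / 20 := by
    have h := (hband (ub + 1)).2
    have e : incr w (ub + 1) = w (ub + 1) - w ub := by simp [incr]
    rw [e, inner_sub_left] at h
    linarith
  by_cases hc : x₀ - ⟪w ub, n⟫ ≤ 23 / 40
  · exact ⟨ub, by rw [abs_le]; constructor <;> linarith⟩
  · push Not at hc
    exact ⟨ub + 1, by rw [abs_le]; constructor <;> linarith⟩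

/-- **covering radius**: every point of space is within `23/40 + (‖a‖+‖b‖)/2` of a site of the layered configuration. [this file] -/
theorem exists_near_layered (hab : LinearIndependent ℝ ![a, b]) (hn : IsUnitNormal a b n)
    (hband : ∀ m : ℤ, 3 / 8 ≤ ⟪incr w m, n⟫ ∧ ⟪incr w m, n⟫ ≤ 23 / 20) (x : E3) :
    ∃ p ∈ Layered a b w, dist x p ≤ 23 / 40 + (‖a‖ + ‖b‖) / 2 := by
  obtain ⟨m, hm⟩ := exists_layer_near_height hband ⟪x, n⟫
  have h1 : ⟪n, n⟫ = 1 := by rw [real_inner_self_eq_norm_sq, hn.1]; norm_num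
  have hy : ⟪n, (x - (⟪x, n⟫ - ⟪w m, n⟫) • n) - w m⟫ = 0 := by
    rw [inner_sub_right, inner_sub_right, inner_smul_right, h1, real_inner_comm x n, real_inner_comm (w m) n]
    ring
  obtain ⟨i, j, hij⟩ := exists_layerPoint_near hab hn.1 hn.2.1 hn.2.2 w m hy
  refine ⟨layerPoint a b w (m, i, j), ⟨m, i, j, rfl⟩, ?_⟩
  have hd : dist x (x - (⟪x, n⟫ - ⟪w m, n⟫) • n) ≤ 23 / 40 := by
    rw [dist_eq_norm, sub_sub_cancel, norm_smul, Real.norm_eq_abs, hn.1, mul_one]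
    exact hm
  linarith [dist_triangle x (x - (⟪x, n⟫ - ⟪w m, n⟫) • n) (layerPoint a b w (m, i, j))]

/-! ## §2 The total variation of the layer profile is carried by the shell -/

/-- **a short lattice translate of the layer step** `w (m+1) − w m`. [this file] -/
theorem exists_short_step (hab : LinearIndependent ℝ ![a, b]) (hn : IsUnitNormal a b n)
    (hband : ∀ m : ℤ, 3 / 8 ≤ ⟪incr w m, n⟫ ∧ ⟪incr w m, n⟫ ≤ 23 / 20) (m : ℤ) :
    ∃ g : E3, (∃ i j : ℤ, g = ((i : ℝ) • a + (j : ℝ) • b) + (w (m + 1) - w m)) ∧ ‖g‖ ≤ 23 / 20 + (‖a‖ + ‖b‖) / 2 := by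
  have h1 : ⟪n, n⟫ = 1 := by rw [real_inner_self_eq_norm_sq, hn.1]; norm_num
  have hvn : 3 / 8 ≤ ⟪w (m + 1) - w m, n⟫ ∧ ⟪w (m + 1) - w m, n⟫ ≤ 23 / 20 := by
    have h := hband (m + 1)
    have e : incr w (m + 1) = w (m + 1) - w m := by simp [incr]
    rwa [e] at h
  generalize hv : w (m + 1) - w m = v at hvn ⊢
  have hu : ⟪n, v - ⟪v, n⟫ • n⟫ = 0 := by
    rw [inner_sub_right, inner_smul_right, h1, mul_one, real_inner_comm n v, sub_self]
  obtain ⟨s, t, hst⟩ := exists_coeffs_of_inner_eq_zero hab hn.1 hn.2.1 hn.2.2 hu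
  have hv' : v = s • a + t • b + ⟪v, n⟫ • n := by rw [← hst]; abel
  refine ⟨v - (((round s : ℤ) : ℝ) • a + ((round t : ℤ) : ℝ) • b), ⟨-round s, -round t, ?_⟩, ?_⟩
  · push_cast
    rw [neg_smul, neg_smul]
    try abel
  · have e : v - (((round s : ℤ) : ℝ) • a + ((round t : ℤ) : ℝ) • b) =
        ⟪v, n⟫ • n + ((s - round s) • a + (t - round t) • b) := by
      generalize hc : ⟪v, n⟫ = c at hv' ⊢
      rw [hv', sub_smul, sub_smul]
      abel
    rw [e]
    have hvabs : |⟪v, n⟫| ≤ 23 / 20 := by rw [abs_le]; constructor <;> linarith [hvn.1, hvn.2]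
    calc ‖⟪v, n⟫ • n + ((s - round s) • a + (t - round t) • b)‖
        ≤ ‖⟪v, n⟫ • n‖ + (‖(s - round s) • a‖ + ‖(t - round t) • b‖) :=
          (norm_add_le _ _).trans (add_le_add le_rfl (norm_add_le _ _))
      _ = |⟪v, n⟫| + (|s - round s| * ‖a‖ + |t - round t| * ‖b‖) := by
          rw [norm_smul, norm_smul, norm_smul, Real.norm_eq_abs, Real.norm_eq_abs, Real.norm_eq_abs, hn.1, mul_one]
      _ ≤ 23 / 20 + (1 / 2 * ‖a‖ + 1 / 2 * ‖b‖) :=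
          add_le_add hvabs (add_le_add (mul_le_mul_of_nonneg_right (abs_sub_round s) (norm_nonneg _))
            (mul_le_mul_of_nonneg_right (abs_sub_round t) (norm_nonneg _)))
      _ = 23 / 20 + (‖a‖ + ‖b‖) / 2 := by ring

/-- **one-sided layer comparison**: translating by a lattice translate `g` of `w m' − w m` with `‖g‖ ≤ R₀` maps the layer-`m` sites at coordinate
distance `≥ R₀` from `∂Q` injectively into the layer-`m'` sites, so `N_m ≤ N_{m'} + #(F ∩ shell ∩ layer m)`. [this file] -/
theorem layer_card_le (hab : LinearIndependent ℝ ![a, b]) (hn : IsUnitNormal a b n) (hmono : StrictMono fun m : ℤ => ⟪w m, n⟫)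
    {c : E3} {ℓ R₀ : ℝ} {F : Finset E3} (hF : (↑F : Set E3) = Layered a b w ∩ {z | ∀ i : Fin 3, c i ≤ z i ∧ z i < c i + ℓ})
    {m m' : ℤ} {g : E3} (hg : ∃ i j : ℤ, g = ((i : ℝ) • a + (j : ℝ) • b) + (w m' - w m)) (hgR : ‖g‖ ≤ R₀) :
    (F.filter fun y => layerOf a b w y = m).card ≤ (F.filter fun y => layerOf a b w y = m').card +
      ((F.filter fun z => ∃ i : Fin 3, z i < c i + R₀ ∨ c i + ℓ - R₀ ≤ z i).filter fun y => layerOf a b w y = m).card := by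
  classical
  obtain ⟨i₀, j₀, hg⟩ := hg
  have hsplit := card_filter_add_card_filter_not (s := F.filter fun y => layerOf a b w y = m)
    (fun z => ∃ i : Fin 3, z i < c i + R₀ ∨ c i + ℓ - R₀ ≤ z i)
  have hS : ((F.filter fun y => layerOf a b w y = m).filter fun z => ∃ i : Fin 3, z i < c i + R₀ ∨ c i + ℓ - R₀ ≤ z i) =
      ((F.filter fun z => ∃ i : Fin 3, z i < c i + R₀ ∨ c i + ℓ - R₀ ≤ z i).filter fun y => layerOf a b w y = m) := by
    ext y; simp only [mem_filter]
    constructor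
    · rintro ⟨⟨h1, h2⟩, h3⟩; exact ⟨⟨h1, h3⟩, h2⟩
    · rintro ⟨⟨h1, h2⟩, h3⟩; exact ⟨⟨h1, h3⟩, h2⟩
  have hmap : ((F.filter fun y => layerOf a b w y = m).filter fun z => ¬ ∃ i : Fin 3, z i < c i + R₀ ∨ c i + ℓ - R₀ ≤ z i).card ≤
      (F.filter fun y => layerOf a b w y = m').card := by
    refine card_le_card_of_injOn (fun y => y + g) (fun y hy => ?_) (fun y _ y' _ h => by simpa using h)
    rw [mem_coe, mem_filter, mem_filter] at hy
    obtain ⟨⟨hyF, hym⟩, hysh⟩ := hy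
    push Not at hysh
    have hyF' : y ∈ (↑F : Set E3) := hyF
    rw [hF] at hyF'
    obtain ⟨hyL, -⟩ := hyF'
    obtain ⟨i, j, hy⟩ := layerOf_spec hyL
    rw [hym] at hy
    have hy' : y + g = (((i + i₀ : ℤ) : ℝ) • a + ((j + j₀ : ℤ) : ℝ) • b) + w m' := by
      rw [hy, hg]; push_cast; rw [add_smul, add_smul]; abel
    rw [mem_coe, mem_filter]
    refine ⟨?_, layerOf_eq hab hn hmono hy'⟩
    have hmem : y + g ∈ (↑F : Set E3) := by
      rw [hF]
      refine ⟨⟨m', i + i₀, j + j₀, hy'⟩, fun k => ?_⟩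
      have hgk : |g k| ≤ R₀ := by
        have := PiLp.norm_apply_le g k
        rw [Real.norm_eq_abs] at this
        exact this.trans hgR
      rw [abs_le] at hgk
      obtain ⟨h1, h2⟩ := hysh k
      have e : (y + g) k = y k + g k := rfl
      rw [e]
      constructor <;> linarith
    exact hmem
  rw [← hS]
  omega

/-- **two-sided bound**: `|N_{m+1} − N_m| ≤ S_m + S_{m+1}` with `S_m = #(F ∩ shell_{R₀} ∩ layer m)`, `R₀ = 23/20 + (‖a‖+‖b‖)/2`. [this file] -/
theorem abs_layerCount_sub_le (hab : LinearIndependent ℝ ![a, b]) (hn : IsUnitNormal a b n)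
    (hband : ∀ m : ℤ, 3 / 8 ≤ ⟪incr w m, n⟫ ∧ ⟪incr w m, n⟫ ≤ 23 / 20)
    {c : E3} {ℓ R₀ : ℝ} (hR₀ : 23 / 20 + (‖a‖ + ‖b‖) / 2 ≤ R₀) {F : Finset E3}
    (hF : (↑F : Set E3) = Layered a b w ∩ {z | ∀ i : Fin 3, c i ≤ z i ∧ z i < c i + ℓ}) (m : ℤ) :
    |layerCount a b w F (m + 1) - layerCount a b w F m| ≤
      (((F.filter fun z => ∃ i : Fin 3, z i < c i + R₀ ∨ c i + ℓ - R₀ ≤ z i).filter fun y => layerOf a b w y = m).card : ℝ) +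
      (((F.filter fun z => ∃ i : Fin 3, z i < c i + R₀ ∨ c i + ℓ - R₀ ≤ z i).filter fun y => layerOf a b w y = m + 1).card : ℝ) := by
  classical
  have hmono : StrictMono fun m : ℤ => ⟪w m, n⟫ := strictMono_heights fun m => by linarith [(hband m).1]
  obtain ⟨g, hg, hgR'⟩ := exists_short_step hab hn hband m
  have hgR : ‖g‖ ≤ R₀ := hgR'.trans hR₀
  have h1 := layer_card_le hab hn hmono hF (m := m) (m' := m + 1) hg hgR
  have hg' : ∃ i j : ℤ, -g = ((i : ℝ) • a + (j : ℝ) • b) + (w m - w (m + 1)) := by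
    obtain ⟨i, j, hg⟩ := hg
    refine ⟨-i, -j, ?_⟩
    rw [hg, Int.cast_neg, Int.cast_neg]
    module
  have h2 := layer_card_le hab hn hmono hF (m := m + 1) (m' := m) hg' (show ‖-g‖ ≤ R₀ by rw [norm_neg]; exact hgR)
  set L : ℤ → Finset E3 := fun q => F.filter fun y => layerOf a b w y = q with hL
  set S : ℤ → Finset E3 := fun q =>
    (F.filter fun z => ∃ i : Fin 3, z i < c i + R₀ ∨ c i + ℓ - R₀ ≤ z i).filter fun y => layerOf a b w y = q with hS
  have h1' : ((L m).card : ℝ) ≤ (L (m + 1)).card + (S m).card := by exact_mod_cast h1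
  have h2' : ((L (m + 1)).card : ℝ) ≤ (L m).card + (S (m + 1)).card := by exact_mod_cast h2
  have e1 : layerCount a b w F (m + 1) = (L (m + 1)).card := rfl
  have e2 : layerCount a b w F m = (L m).card := rfl
  show |layerCount a b w F (m + 1) - layerCount a b w F m| ≤ ((S m).card : ℝ) + ((S (m + 1)).card : ℝ)
  rw [e1, e2, abs_sub_le_iff]
  constructor <;> linarith

/-- **TV ≤ 2·#shell**: `Σ_{m∈T} |N_{m+1} − N_m| ≤ 2·#(F ∩ shell_{R₀})`. [this file] -/
theorem sum_abs_layerCount_sub_le (hab : LinearIndependent ℝ ![a, b]) (hn : IsUnitNormal a b n)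
    (hband : ∀ m : ℤ, 3 / 8 ≤ ⟪incr w m, n⟫ ∧ ⟪incr w m, n⟫ ≤ 23 / 20)
    {c : E3} {ℓ R₀ : ℝ} (hR₀ : 23 / 20 + (‖a‖ + ‖b‖) / 2 ≤ R₀) {F : Finset E3}
    (hF : (↑F : Set E3) = Layered a b w ∩ {z | ∀ i : Fin 3, c i ≤ z i ∧ z i < c i + ℓ}) (T : Finset ℤ) :
    ∑ m ∈ T, |layerCount a b w F (m + 1) - layerCount a b w F m| ≤
      2 * ((F.filter fun z => ∃ i : Fin 3, z i < c i + R₀ ∨ c i + ℓ - R₀ ≤ z i).card : ℝ) := by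
  classical
  set Fsh := F.filter fun z => ∃ i : Fin 3, z i < c i + R₀ ∨ c i + ℓ - R₀ ≤ z i with hFsh
  have hfib : ∀ T' : Finset ℤ, ∑ m ∈ T', ((Fsh.filter fun y => layerOf a b w y = m).card : ℝ) ≤ Fsh.card := by
    intro T'
    have h := sum_card_fiberwise_eq_card_filter Fsh T' (layerOf a b w)
    have h2 : (Fsh.filter fun y => layerOf a b w y ∈ T').card ≤ Fsh.card := card_filter_le _ _
    exact_mod_cast h.le.trans h2
  have hshift : ∑ m ∈ T, ((Fsh.filter fun y => layerOf a b w y = m + 1).card : ℝ) =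
      ∑ m ∈ T.image (· + 1), ((Fsh.filter fun y => layerOf a b w y = m).card : ℝ) := by
    rw [sum_image fun x _ y _ h => by simpa using h]
  calc ∑ m ∈ T, |layerCount a b w F (m + 1) - layerCount a b w F m|
      ≤ ∑ m ∈ T, (((Fsh.filter fun y => layerOf a b w y = m).card : ℝ) + ((Fsh.filter fun y => layerOf a b w y = m + 1).card : ℝ)) :=
        sum_le_sum fun m _ => abs_layerCount_sub_le hab hn hband hR₀ hF m
    _ = ∑ m ∈ T, ((Fsh.filter fun y => layerOf a b w y = m).card : ℝ) +
          ∑ m ∈ T.image (· + 1), ((Fsh.filter fun y => layerOf a b w y = m).card : ℝ) := by rw [sum_add_distrib, hshift]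
    _ ≤ Fsh.card + Fsh.card := add_le_add (hfib T) (hfib _)
    _ = 2 * (Fsh.card : ℝ) := by ring

/-! ## §3 THIN holds -/

/-- ★ **THIN HOLDS**: `LayerProfileThin Λ₁` for `Λ₁ ≤ 17/16` — the layer profile of the sites in a cube of side `ℓ` has total variation
`≤ 2·#shell = O(ℓ²) ≤ ε·#F` for `ℓ ≥ ℓ₁(ε)`, since `#F ≥ (ℓ/4 − 2)³`. [this file] -/
theorem layerProfileThin_holds {Λ₁ : ℝ} (hΛ₁ : Λ₁ ≤ 17 / 16) : LayerProfileThin Λ₁ := by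
  intro δ hδ a b w hab ha hb hsep n hn hband ε hε
  obtain ⟨R₀, hR⟩ : ∃ R₀ : ℝ, R₀ = 23 / 20 + Λ₁ := ⟨_, rfl⟩
  have hR₀ : 0 < R₀ := by rw [hR]; linarith [norm_nonneg a]
  have hR₀' : 23 / 20 + (‖a‖ + ‖b‖) / 2 ≤ R₀ := by rw [hR]; linarith
  set A : ℝ := 2 * (9 * (4 * R₀ / δ + 1) ^ 3) with hA
  have hA0 : 0 ≤ A := by positivity
  refine ⟨max 16 (max R₀ (2048 * A / (ε * R₀ ^ 2))), fun ℓ hℓ c F hF T => ?_⟩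
  have hℓ16 : 16 ≤ ℓ := le_trans (le_max_left _ _) hℓ
  have hℓR : R₀ ≤ ℓ := le_trans ((le_max_left _ _).trans (le_max_right _ _)) hℓ
  have hℓA : 2048 * A / (ε * R₀ ^ 2) ≤ ℓ := le_trans ((le_max_right _ _).trans (le_max_right _ _)) hℓ
  -- total variation ≤ 2·#shell
  have h1 := sum_abs_layerCount_sub_le hab hn hband hR₀' hF T
  -- the shell count
  have hmemF : ∀ x ∈ F, x ∈ Layered a b w ∧ ∀ i : Fin 3, c i ≤ x i ∧ x i < c i + ℓ := by
    intro x hx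
    have hx' : x ∈ (↑F : Set E3) := hx
    rw [hF] at hx'
    exact hx'
  have hsepF : ∀ x ∈ F, ∀ y ∈ F, x ≠ y → δ ≤ dist x y :=
    fun x hx y hy hxy => hsep x (hmemF x hx).1 y (hmemF y hy).1 hxy
  have h2 := card_filter_shell_le (F := F) (c := c) (R₀ := R₀) (by linarith) hR₀ (by linarith) hsepF fun z hz => (hmemF z hz).2
  -- the bulk count
  have hR₁ : 23 / 40 + (‖a‖ + ‖b‖) / 2 < 2 := by linarith
  have h3 := card_ge_of_covering hR₁ (exists_near_layered hab hn hband) (by linarith) hF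
  -- arithmetic
  have hx : 1 ≤ ℓ / R₀ := (one_le_div hR₀).2 hℓR
  have h4 : (ℓ / R₀ + 1) ^ 2 ≤ (2 * (ℓ / R₀)) ^ 2 := pow_le_pow_left₀ (by positivity) (by linarith) 2
  have h5 : (ℓ / 8) ^ 3 ≤ (ℓ / 4 - 2) ^ 3 := pow_le_pow_left₀ (by positivity) (by linarith) 3
  have h6 : 2048 * A ≤ ℓ * (ε * R₀ ^ 2) := (div_le_iff₀ (by positivity)).1 hℓA
  have h7 : A * (2 * (ℓ / R₀)) ^ 2 ≤ ε * (ℓ / 8) ^ 3 := by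
    have e1 : A * (2 * (ℓ / R₀)) ^ 2 = 4 * A * ℓ ^ 2 / R₀ ^ 2 := by rw [mul_pow, div_pow]; ring
    rw [e1, div_le_iff₀ (by positivity)]
    have h8 : 2048 * A * ℓ ^ 2 ≤ ℓ * (ε * R₀ ^ 2) * ℓ ^ 2 := mul_le_mul_of_nonneg_right h6 (sq_nonneg ℓ)
    have e2 : ε * (ℓ / 8) ^ 3 * R₀ ^ 2 = ℓ * (ε * R₀ ^ 2) * ℓ ^ 2 / 512 := by ring
    rw [e2]
    linarith
  calc ∑ m ∈ T, |layerCount a b w F (m + 1) - layerCount a b w F m|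
      ≤ 2 * ((F.filter fun z => ∃ i : Fin 3, z i < c i + R₀ ∨ c i + ℓ - R₀ ≤ z i).card : ℝ) := h1
    _ ≤ A * (ℓ / R₀ + 1) ^ 2 := by rw [hA]; nlinarith [h2]
    _ ≤ A * (2 * (ℓ / R₀)) ^ 2 := mul_le_mul_of_nonneg_left h4 hA0
    _ ≤ ε * (ℓ / 8) ^ 3 := h7
    _ ≤ ε * (ℓ / 4 - 2) ^ 3 := mul_le_mul_of_nonneg_left h5 hε.le
    _ ≤ ε * F.card := mul_le_mul_of_nonneg_left h3 hε.le

/-- ★ **STR-A HOLDS**: the affine straightened floor `AffineStraightenedFloor (17/16)` (part O) is a theorem (parts P, Q, R, S, T). [this file] -/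
theorem affineStraightenedFloor_holds : AffineStraightenedFloor (17 / 16) :=
  affineStraightenedFloor_of_thin le_rfl (layerProfileThin_holds le_rfl)

/-! ## §4 Cone XXXVI: cone XXXV with THIN discharged -/

/-- **Cone XXXVI** (= cone XXXV `…EnergyAffineFloor.rdef_thirtyfifth_of_recordK_thin_ref` with THIN `LayerProfileThin (17/16)` PROVED):
beneath ★ `StackedCellPinningU` the remaining energy-side leaves are GEO-OSC `StackedHeightsOsc (17/16) ω` [CERT·S] and the finite certificates
FIN-A-T `AffineCellEnergyT` / FIN-A-S `AffineSquareExtinct` [CERT·M]; all other hypotheses as in cone XXXV. [this file] -/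
theorem rdef_thirtysixth_of_recordK_ref (s₁ s₂ h₀ κ' ω B : ℝ) (s₀ : ℕ) (hκ' : 0 < κ') (hs₀ : 4 ≤ s₀)
    (hG : GrossCleanBallsU (1 / 250) 10)
    (hCEG : ChargedEnergyGap) (hC : CompressedVirialLaw (1 / 250) 10) (hS : TwoShellShape (1 / 100) (3 / 50) (1 / 450)) (hB₂ : BarlowGluingW)
    (hD : DoorPeriodicW 2) (hSR : StackedReductionW 2 (17 / 16)) (hV : GapStressVanishesW (17 / 16))
    (hP : RegistryPinningP (17 / 16) (1 / 40) (3 / 16) s₁ s₂ 1 0) (hT : TubeConvexRefP (17 / 16) (1 / 40) s₁ s₂ 1 0)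
    (hOSC : StackedHeightsOsc (17 / 16) ω)
    (hFT : AffineCellEnergyT (17 / 16) s₁ s₂ ω s₀ B (eStar + 2 * κ')) (hFS : AffineSquareExtinct (17 / 16) ω s₀ B (eStar + 2 * κ'))
    (hGeo : RegistryGeometryW (17 / 16) s₁ s₂ h₀ (3 / 20))
    (hBal : BalancedLocus s₁ s₂ h₀ (1 / 40)) (hR1 : RegistryResidual s₁ s₂ (1 / 250)) (hR2 : RegistryTube s₁ s₂ (1 / 100) 1)
    (hMet : RegistryMetricCW s₁ s₂ (3 / 500)) (hCE : CleanlessExcessT) (hRes : CoherentResidual 10) : RobustDefectLimitWindows :=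
  rdef_thirtyfifth_of_recordK_thin_ref s₁ s₂ h₀ κ' ω B s₀ hκ' hs₀ hG hCEG hC hS hB₂ hD hSR hV hP hT
    (layerProfileThin_holds le_rfl) hOSC hFT hFS hGeo hBal hR1 hR2 hMet hCE hRes

end Summit.AtomisticToContinuum.Crystallization.Theorems.OverbindingBudgetEnergyThinProfiles

end
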